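import Literature.AnabelianGeometry.EtaleTheta.Discharge.Sec5ThetaInputOfThetaTower
import Literature.AnabelianGeometry.EtaleTheta.ThetaTwistTowerThetaCoordinate
import Mathlib.CategoryTheory.SingleObj
import HarnessLib

/-!
# [IUTchI] Example 3.2 tempered side `TemperedThetaInput`, v2: the theta slot `Θ̲_v ∈ 𝒪^×(T^÷_{Ÿ_v})` filled by the ε-free theta
# tower's Θ̈-KUMMER COORDINATE generator, through a birationalization STAND-IN `ℱ÷_v := ℱ̲_v × B(L_Θ)` — a MODEL (class (b))

S. Mochizuki, *Inter-universal Teichmüller theory I*, Example 3.2 (ii) p.70 («the birationalization `ℱ÷_v := ℱ̲_v^birat`», «`Θ̲_v ∈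
𝒪^×(T^÷_{Ÿ_v})`») [claim: Mochizuki2012, status: disputed] (D-0012 claim key; nothing of the series asserted); *The étale theta function …*
[MochizukiEtTh2009], §1 p.239 (PDF p.13) (compatible systems of roots), §5 p.327 (PDF p.101) («`(l·Δ_Θ)_D ⊆ Aut^Θ_D(D)`»)
[cite: MochizukiEtTh2009, §5 p.327 (PDF p.101)]; [FrdI] Prop. 4.4 (the birationalization of a Frobenioid — NOT in the tree; replaced here
by a labelled stand-in).

abc-iut cell, seat abc-iut-L2-t6 gen 13 (layer L2); row «THETA-INPUT@THETA-COORD» (abc-iut-L2-lead gen 8 R1277, silence-GO 06:42Z): the v1 MODEL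
`ThetaInputOfThetaTower.model` (this seat, p504264: `ℱ̲_v := C_{A₀} ⊕ (𝒞⊢_v ⊕ 𝒞^Θ_v)`, `birat := 𝟭`, `Θ̲_v := 1`) with the theta slot made
NON-TRIVIAL.  WHY a stand-in is needed: with `birat := 𝟭` the slot `Aut(T^÷_Ÿ)` is `Aut` of the Frobenius-trivial object `(Ÿ, 0)` of the
[EtTh] model category, i.e. units of ZERO divisor — no Θ̈-content can live there; print puts `Θ̲_v` in the BIRATIONALIZATION, where every
rational function becomes a unit.  Stand-in: **`ℱ÷_v := ℱ̲_v × B(L_Θ)`** (Mathlib `SingleObj`), `L_Θ := Multiplicative ↥ThetaCoord.compatFam ≅ Ẑ`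
= abc-iut-L2-t4's Θ̈-KUMMER COORDINATE group of the fourth tower model (`ThetaTwistTowerThetaCoordinate`, p504128: the subgroup
`thetaEmb : L_Θ ↪ Compat₃′` of compatible families of indices of the roots of `Θ̈`; level arithmetic `thetaEval`, `card_range_thetaEval`,
p504128/p504739, BY NAME), `birat := 𝟭 ×' const ⋆` (so `birat ⋙ fst = 𝟭` and the base is unchanged ON THE NOSE), `biratBase := fst ⋙ toBase`.
* §1 `LTheta`, **`thetaGen`** (`ϑ :=` the compatible family `(1 mod M_n)_n`, the class of `Θ̈`'s root system), `thetaGen_ne_one`.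
* §2 `BiratCarrier`, `birat`, `biratBase`, `biratBaseIso`, **`thetaAut := (𝟙_{T_Ÿ}, ϑ)`** (`Iso.prod` / `Units.toAut`), `cThetaBirat`
  (faithful), `cThetaBiratBaseIso`.
* §3 **`ThetaInputOfThetaTower.modelΘ T hq R S A₀ : TemperedThetaInput d T hq Carrier BiratCarrier HullCarrier`** — every field of v1 BY
  NAME (`toBase`, `hull`, `hull_faithful`, `cdashBaseIso`, `cTheta`), plus `Θ̲_v := thetaAut`, `𝒪^×(T^÷_Ÿ) := zpowers Θ̲_v`
  (commutative), `l·ℤ := ⊥`, constants `:= 1`; §4 `modelΘ_theta_hom_snd` (`= ϑ`), **`modelΘ_theta_ne_one`**, `modelΘ_unitsTY`,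
  `modelΘ_lZ`, `modelΘ_CdashToC`, `modelΘ_Tobj`, `nonempty_modelΘ`.
LABEL (travels with every use): «MODEL tempered side v2: `ℱ̲_v`/`𝒞_v`-summands = [EtTh] Def. 3.6 (ii) category + hull of the ε-free theta
tower at one covering (v1); `ℱ÷_v` = birationalization STAND-IN `ℱ̲_v × B(L_Θ)`, NOT [FrdI] Prop. 4.4; `Θ̲_v` = the generator of the tower's
Θ̈-Kummer COORDINATE group `L_Θ ≅ Ẑ`, NOT print's Kummer class of the function `Θ̈` on `Ÿ` (residual displayed: «coordinate ϑ vs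
the Θ̈-function as a unit of the genuine birationalization»); `l·ℤ`, constants trivial; `𝒞⊢_v`, `𝒞^Θ_v` formal summands; NO [IUTchI]
Ex. 3.2 (i) token».  No instance, no notation, no `Prop` fact, no sorry; nothing here bears on [IUTchIII] Cor. 3.12; typed ≠ inhabited ≠ proved.
-/

noncomputable section

namespace Literature.AnabelianGeometry.EtaleTheta

namespace ThetaInputOfThetaTower

open CategoryTheory Opposite Literature.AlgebraicGeometry.Frobenioids Literature.AlgebraicGeometry.Frobenioids.PadicFrd
  Literature.AnabelianGeometry.SemiGraphs Literature.IUT.HodgeTheaters TateTowerKummerTwistRShear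
open TateTowerKummerTwist (M one_lt_M)

/-! ## §1 The Θ̈-Kummer coordinate group `L_Θ ≅ Ẑ` and its generator -/

/-- `L_Θ := Multiplicative ↥compatFam` — abc-iut-L2-t4's group of compatible families `(a_n)_n ∈ ∏_n ℤ/M_n` (the Θ̈-Kummer coordinate of the
fourth tower model, embedded in `Compat₃′` by `ThetaCoord.thetaEmb`), written multiplicatively. [cite: MochizukiEtTh2009, §5 p.327 (PDF p.101)] -/
abbrev LTheta : Type := Multiplicative ↥ThetaCoord.compatFam

/-- **`ϑ`, the generator of `L_Θ`**: the compatible INTEGER family `(1 mod M_n)_n` (the class of the compatible system of roots of `Θ̈`;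
`ThetaCoord.ofInt 1`). [cite: MochizukiEtTh2009, §1 p.239 (PDF p.13)] -/
def thetaGen : LTheta := Multiplicative.ofAdd (ThetaCoord.ofInt 1)

/-- `ϑ ≠ 1` (its level-`0` coordinate is `1 ≠ 0` in `ℤ/M_0`, `M_0 > 1`). [cite: MochizukiEtTh2009, §1 p.239 (PDF p.13)] -/
theorem thetaGen_ne_one : thetaGen ≠ 1 := by
  intro h
  have h1 : ((Multiplicative.toAdd thetaGen : ↥ThetaCoord.compatFam) : ∀ n, ZMod (M n)) 0 = 0 := by
    rw [h]; rfl
  change ((1 : ℤ) : ZMod (M 0)) = 0 at h1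
  rw [Int.cast_one] at h1
  haveI : Fact (1 < M 0) := ⟨one_lt_M 0⟩
  exact one_ne_zero h1

/-! ## §2 The birationalization stand-in `ℱ÷_v := ℱ̲_v × B(L_Θ)` -/

variable {p : ℕ} [Fact p.Prime] {d : GaloisValDatum.{0} p} {P : Type} [Group P] [TopologicalSpace P]
  (T : BadLocalGroupDatum d.Gal P) {qroot : intNonzero d.k} (hq : ¬ IsUnit qroot)
  (R S : ((CosetCat P)ᵒᵖ ⥤ CommMonCat.{0}) → Prop) (A₀ : ConnectedPart (BTemp TateTowerKummerTwistRShear.Compat₃'))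

/-- **`ℱ÷_v := ℱ̲_v × B(L_Θ)`** — the v1 carrier with the commutative group `L_Θ` of «birational units» formally adjoined at every object
(birationalization STAND-IN). [cite: MochizukiEtTh2009, §5 p.327 (PDF p.101)] -/
abbrev BiratCarrier : Type := Carrier T hq R S A₀ × SingleObj LTheta

/-- `ℱ̲_v → ℱ÷_v`: `X ↦ (X, ⋆)`, `f ↦ (f, 1)`. [cite: MochizukiEtTh2009, §5 p.327 (PDF p.101)] -/
def birat : Carrier T hq R S A₀ ⥤ BiratCarrier T hq R S A₀ :=
  (𝟭 _).prod' ((Functor.const _).obj (SingleObj.star LTheta))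

/-- `ℱ÷_v → 𝒟_v`: forget the adjoined units, then the v1 structure functor. [cite: MochizukiEtTh2009, §5 p.327 (PDF p.101)] -/
def biratBase : BiratCarrier T hq R S A₀ ⥤ T.Dv :=
  CategoryTheory.Prod.fst _ _ ⋙ toBase T hq R S A₀

/-- `ℱ̲_v → ℱ÷_v → 𝒟_v` is `ℱ̲_v → 𝒟_v`. [cite: MochizukiEtTh2009, §5 p.327 (PDF p.101)] -/
def biratBaseIso : birat T hq R S A₀ ⋙ biratBase T hq R S A₀ ≅ toBase T hq R S A₀ :=
  (Functor.associator _ _ _).symm ≪≫ Functor.isoWhiskerRight (Functor.prod'CompFst _ _) _ ≪≫ (toBase T hq R S A₀).leftUnitor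

/-- **`Θ̲_v := (𝟙_{T_Ÿ}, ϑ)`** — the automorphism of `T^÷_Ÿ = (T_Ÿ, ⋆)` given by the generator of `L_Θ` on the adjoined factor.
[cite: MochizukiEtTh2009, §5 p.327 (PDF p.101)] -/
def thetaAut : Aut ((birat T hq R S A₀).obj (Sum.inl (⟨T.ydd, 1⟩ : (frd R S A₀).category))) :=
  Iso.prod (Iso.refl _) (Units.toAut LTheta (toUnits thetaGen))

/-- The `B(L_Θ)`-component of `Θ̲_v` is `ϑ`. [cite: MochizukiEtTh2009, §5 p.327 (PDF p.101)] -/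
theorem thetaAut_hom_snd : (thetaAut T hq R S A₀).hom.2 = thetaGen := rfl

/-- **`Θ̲_v ≠ 1`.** [cite: MochizukiEtTh2009, §5 p.327 (PDF p.101)] -/
theorem thetaAut_ne_one : thetaAut T hq R S A₀ ≠ 1 := by
  intro h
  apply thetaGen_ne_one
  have h2 := congrArg
    (fun i : Aut ((birat T hq R S A₀).obj (Sum.inl (⟨T.ydd, 1⟩ : (frd R S A₀).category))) => i.hom.2) h
  exact h2

/-- `𝒞^Θ_v → ℱ÷_v`: the v1 inclusion followed by `birat`. [cite: Mochizuki2012, I Ex 3.2 (v) p.72] -/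
def cThetaBirat : T.CTheta d hq ⥤ BiratCarrier T hq R S A₀ :=
  cTheta T hq R S A₀ ⋙ birat T hq R S A₀

/-- `birat` is faithful (its first component is the identity). [cite: MochizukiEtTh2009, §5 p.327 (PDF p.101)] -/
theorem birat_faithful : (birat T hq R S A₀).Faithful :=
  ⟨fun {_ _} _ _ h => congrArg Prod.fst h⟩

/-- `𝒞^Θ_v → ℱ÷_v` is faithful. [cite: Mochizuki2012, I Ex 3.2 (v) p.72] -/
theorem cThetaBirat_faithful : (cThetaBirat T hq R S A₀).Faithful :=
  haveI := cTheta_faithful T hq R S A₀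
  haveI := birat_faithful T hq R S A₀
  Functor.Faithful.comp _ _

/-- `𝒞^Θ_v → ℱ÷_v → 𝒟_v` is `𝒞^Θ_v → 𝒟^Θ_v ⊆ (𝒟_v)_{Ÿ_v} → 𝒟_v`. [cite: Mochizuki2012, I Ex 3.2 (v) p.72] -/
def cThetaBiratBaseIso :
    cThetaBirat T hq R S A₀ ⋙ biratBase T hq R S A₀ ≅ T.CThetaBase d hq ⋙ T.dThetaIncl ⋙ Over.forget T.ydd :=
  Functor.associator _ _ _ ≪≫ Functor.isoWhiskerLeft _ (biratBaseIso T hq R S A₀) ≪≫ cThetaBaseIso T hq R S A₀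

/-! ## §3 The MODEL tempered side v2 with a non-trivial `Θ̲_v` -/

/-- **THE MODEL TEMPERED SIDE v2**: the v1 model's `ℱ̲_v`, `𝒞_v`, structure functor, hull and `𝒞⊢_v`/`𝒞^Θ_v` summands, with
`ℱ÷_v := ℱ̲_v × B(L_Θ)` and **`Θ̲_v := (𝟙_{T_Ÿ}, ϑ)`**, `ϑ` the generator of the tower's Θ̈-Kummer coordinate group; `𝒪^×(T^÷_Ÿ) := ⟨Θ̲_v⟩`,
`l·ℤ := ⊥`, constants trivial.  LABEL «MODEL v2; birationalization STAND-IN; Θ̲_v = coordinate generator; no Ex. 3.2 (i) token».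
[cite: Mochizuki2012, I Ex 3.2 (ii) p.70] -/
def modelΘ : TemperedThetaInput d T hq (Carrier T hq R S A₀) (BiratCarrier T hq R S A₀) (HullCarrier hq R S A₀) where
  toBase := toBase T hq R S A₀
  Tobj A := Sum.inl ⟨A, 1⟩
  Tobj_base A := Iso.refl A
  birat := birat T hq R S A₀
  biratBase := biratBase T hq R S A₀
  birat_base := ⟨biratBaseIso T hq R S A₀⟩
  unitsTY := Subgroup.zpowers (thetaAut T hq R S A₀)
  unitsTY_comm x hx y hy := by
    obtain ⟨i, rfl⟩ := Subgroup.mem_zpowers_iff.mp hx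
    obtain ⟨j, rfl⟩ := Subgroup.mem_zpowers_iff.mp hy
    exact zpow_mul_comm _ i j
  theta := thetaAut T hq R S A₀
  theta_mem := Subgroup.mem_zpowers _
  lZ := ⊥
  constUnits := 1
  hull := hull T hq R S A₀
  hull_faithful := hull_faithful T hq R S A₀
  CdashToC := Sum.inr_ _ _
  CdashToC_faithful := sum_inr_faithful _ _
  CdashToC_base := ⟨cdashBaseIso T hq R S A₀⟩
  CThetaToBirat := cThetaBirat T hq R S A₀
  CThetaToBirat_faithful := cThetaBirat_faithful T hq R S A₀
  CThetaToBirat_base := ⟨cThetaBiratBaseIso T hq R S A₀⟩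

/-! ## §4 Honesty and content -/

/-- **CONTENT: `Θ̲_v` of the v2 model is NOT trivial** (v1 had `Θ̲_v = 1`). [cite: Mochizuki2012, I Ex 3.2 (ii) p.70] -/
theorem modelΘ_theta_ne_one : (modelΘ T hq R S A₀).theta ≠ 1 := thetaAut_ne_one T hq R S A₀

/-- `Θ̲_v` reads `ϑ` (the generator of `L_Θ`) on the adjoined factor. [cite: MochizukiEtTh2009, §5 p.327 (PDF p.101)] -/
theorem modelΘ_theta_hom_snd : (modelΘ T hq R S A₀).theta.hom.2 = thetaGen := rfl

/-- `𝒪^×(T^÷_Ÿ)` of the v2 model is the cyclic group of `Θ̲_v`. [cite: Mochizuki2012, I Ex 3.2 (ii) p.70] -/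
theorem modelΘ_unitsTY : (modelΘ T hq R S A₀).unitsTY = Subgroup.zpowers (thetaAut T hq R S A₀) := rfl

/-- HONESTY: `l·ℤ` of the v2 model is trivial. [cite: Mochizuki2012, I Ex 3.2 (ii) p.71] -/
theorem modelΘ_lZ : (modelΘ T hq R S A₀).lZ = ⊥ := rfl

/-- HONESTY: `𝒞⊢_v → 𝒞_v` is the formal summand inclusion (as in v1). [cite: Mochizuki2012, I Ex 3.2 (iv) p.71] -/
theorem modelΘ_CdashToC : (modelΘ T hq R S A₀).CdashToC = Sum.inr_ _ _ := rfl

/-- The Frobenius-trivial object over `A` is the v1 object `(A, 0)` of the [EtTh] model category, over `A` on the nose.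
[cite: Mochizuki2012, I Ex 3.2 (i) p.70] -/
theorem modelΘ_toBase_obj_Tobj (A : T.Dv) : (modelΘ T hq R S A₀).toBase.obj ((modelΘ T hq R S A₀).Tobj A) = A := rfl

/-- The v2 model keeps v1's [EtTh] content: at every object of `𝒟_v`, `Φ ⊋ Φ^{bs-fld}` on the `ℱ̲_v`-summand (v1's
`model_exists_mem_Φ_not_mem_bsFld`). [cite: MochizukiEtTh2009, Def 3.6 p.77] -/
theorem modelΘ_exists_mem_Φ_not_mem_bsFld (A : T.Dv) :
    ∃ x ∈ (frd R S A₀).Φ.carrier (op A), x ∉ (frd R S A₀).bsFld.carrier (op A) :=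
  model_exists_mem_Φ_not_mem_bsFld T R S A₀ A

/-- **The INPUT interface of Ex. 3.2 is inhabited with a NON-TRIVIAL theta slot** over every group datum, non-unit `q̲` and covering `A₀`.
[cite: Mochizuki2012, I Ex 3.2 (ii) p.70] -/
theorem nonempty_modelΘ :
    ∃ I : TemperedThetaInput d T hq (Carrier T hq R S A₀) (BiratCarrier T hq R S A₀) (HullCarrier hq R S A₀), I.theta ≠ 1 :=
  ⟨modelΘ T hq R S A₀, modelΘ_theta_ne_one T hq R S A₀⟩

end ThetaInputOfThetaTower

end Literature.AnabelianGeometry.EtaleTheta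

end
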